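import Mathlib
import Summits.Ventures.PercRepro2.Tail2D
import Summits.Ventures.PercRepro2.Tail2DSP
import Summits.Ventures.PercRepro2.Tail2DExchange
import Summits.Ventures.PercRepro2.Tail2DThreePoint

/-!
# The pair-coefficient sign rule of the (M2) defect (seat mine-b, cell pub-perc-repro2)

For an M♮-concave tail `T` (`IsMTail`) and a law `N` on `ℤ²`, the `m2` defect of the convolution
`T′ = T ⊛ N` at `z` is the quadratic form `Σ_{s,t} N(s) N(t) · B(z-s, z-t)` in the weights of `N`, with the
cross bracket `B(u, v) = T(u+e₁+w)·T(v) − T(u+e₁)·T(v+w)` (`w = (1,-1)`).  The coefficient of `N(s)N(t)` is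
`B(u,v) + B(v,u)`, `u = z - s`, `v = z - t`.  We prove it is `≤ 0` whenever `|u₁ − v₁| ≤ 1` (any vertical
distance): for `u − v = (0, k)` and `(1, k)` one of the two brackets is a cone-monotonicity instance
(`dw_cone`), the other is closed by the two-bracket lemma of Tail2DThreePoint.lean with a `d1_quad`
instance and the product of two `m2`'s — exactly the mechanism of the three-point step, which is the
case of the three pairs `{(0,0), (1,0), (0,1)}`.  (On the census of conjectures/MINE-B.md §32.3 the
coefficient is unsigned as soon as `|u₁ − v₁| ≥ 2`.)
-/

namespace Summit.Ventures.PercRepro2.Tail2D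

/-- the cross bracket of `m2`: `T(u+e₁+w)·T(v) − T(u+e₁)·T(v+w)` -/
noncomputable def crossB (T : ℤ → ℤ → ℝ) (u₁ u₂ v₁ v₂ : ℤ) : ℝ :=
  T (u₁ + 2) (u₂ - 1) * T v₁ v₂ - T (u₁ + 1) u₂ * T (v₁ + 1) (v₂ - 1)

namespace IsMTail

variable {T : ℤ → ℤ → ℝ} {L : ℤ} (hT : IsMTail T L)

include hT

/-- the bracket `crossB T u v` is `≤ 0` when `u₁ + 1 ≥ v₁` and `u₂ ≤ v₂`
(`T(z+w)/T(z)` is non-increasing from `v` to `u + e₁`) -/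
lemma crossB_nonpos {u₁ u₂ v₁ v₂ : ℤ} (h1 : v₁ ≤ u₁ + 1) (h2 : u₂ ≤ v₂) :
    crossB T u₁ u₂ v₁ v₂ ≤ 0 := by
  unfold crossB
  have := hT.dw_cone (a := v₁) (b := v₂) (a' := u₁ + 1) (b' := u₂) h1 h2
  rw [show u₁ + 1 + 1 = u₁ + 2 by ring] at this
  linarith [this, mul_comm (T (u₁ + 2) (u₂ - 1)) (T v₁ v₂), mul_comm (T (v₁ + 1) (v₂ - 1)) (T (u₁ + 1) u₂)]

/-- the product of `m2` at `u` and `m2` at `v` -/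
lemma m2_mul_m2 (u₁ u₂ v₁ v₂ : ℤ) :
    (T (u₁ + 2) (u₂ - 1) * T u₁ u₂) * (T (v₁ + 2) (v₂ - 1) * T v₁ v₂)
      ≤ (T (u₁ + 1) u₂ * T (u₁ + 1) (u₂ - 1)) * (T (v₁ + 1) v₂ * T (v₁ + 1) (v₂ - 1)) :=
  mul_le_mul (hT.m2 u₁ u₂) (hT.m2 v₁ v₂) (mul_nonneg (hT.nonneg _ _) (hT.nonneg _ _))
    (mul_nonneg (hT.nonneg _ _) (hT.nonneg _ _))

/-- **the pair coefficient is non-positive on vertical pairs**: `u = v + (0, k)`, `k ≥ 1` -/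
lemma pair_vert {v₁ v₂ : ℤ} {k : ℤ} (hk : 1 ≤ k) :
    crossB T v₁ (v₂ + k) v₁ v₂ + crossB T v₁ v₂ v₁ (v₂ + k) ≤ 0 := by
  -- the signed bracket is crossB v u, the unsigned one crossB u v
  have hs : crossB T v₁ v₂ v₁ (v₂ + k) ≤ 0 := hT.crossB_nonpos (by omega) (by omega)
  unfold crossB at hs ⊢
  -- two_bracket with a = T(v+e₁+w)T(u), b = T(v+e₁)T(u+w), c = T(u+e₁+w)T(v), d = T(u+e₁)T(v+w)
  have key := two_bracket (a := T (v₁ + 2) (v₂ - 1) * T v₁ (v₂ + k)) (b := T (v₁ + 1) v₂ * T (v₁ + 1) (v₂ + k - 1))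
    (c := T (v₁ + 2) (v₂ + k - 1) * T v₁ v₂) (d := T (v₁ + 1) (v₂ + k) * T (v₁ + 1) (v₂ - 1))
    (mul_nonneg (hT.nonneg _ _) (hT.nonneg _ _)) (mul_nonneg (hT.nonneg _ _) (hT.nonneg _ _))
    (mul_nonneg (hT.nonneg _ _) (hT.nonneg _ _)) (by linarith [hs])
    (by
      -- c ≤ b : Δ₁ log T non-increasing from v to v + (1, k-1) (quadrant)
      have := hT.d1_quad (a := v₁) (b := v₂) (a' := v₁ + 1) (b' := v₂ + k - 1) (by omega) (by omega)
      rw [show v₁ + 1 + 1 = v₁ + 2 by ring] at this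
      linarith [this, mul_comm (T (v₁ + 2) (v₂ + k - 1)) (T v₁ v₂)])
    (by
      have := hT.m2_mul_m2 v₁ v₂ v₁ (v₂ + k)
      nlinarith [this])
  linarith [key]

/-- **the pair coefficient is non-positive on the pairs `u = v + (1, k)`**, any `k` -/
lemma pair_diag {v₁ v₂ k : ℤ} :
    crossB T (v₁ + 1) (v₂ + k) v₁ v₂ + crossB T v₁ v₂ (v₁ + 1) (v₂ + k) ≤ 0 := by
  have e1 : v₁ + 1 + 1 = v₁ + 2 := by ring
  have e2 : v₁ + 1 + 2 = v₁ + 3 := by ring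
  have e3 : v₁ + 2 + 1 = v₁ + 3 := by ring
  rcases le_or_gt k 0 with hk | hk
  · -- crossB u v is signed (e₁ + d ∈ C_w); for k = 0 both are
    have hs : crossB T (v₁ + 1) (v₂ + k) v₁ v₂ ≤ 0 := hT.crossB_nonpos (by omega) (by omega)
    rcases eq_or_lt_of_le hk with hk0 | hk0
    · subst hk0
      have hs' : crossB T v₁ v₂ (v₁ + 1) (v₂ + 0) ≤ 0 := hT.crossB_nonpos (by omega) (by omega)
      linarith [hs, hs']
    · -- two_bracket with the roles: a - b = crossB u v, c - d = crossB v u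
      unfold crossB at hs ⊢
      simp only [e1, e2] at hs ⊢
      have hcb : T (v₁ + 2) (v₂ - 1) * T (v₁ + 1) (v₂ + k) ≤ T (v₁ + 2) (v₂ + k) * T (v₁ + 1) (v₂ - 1) := by
        have := hT.d1_quad (a := v₁ + 1) (b := v₂ + k) (a' := v₁ + 1) (b' := v₂ - 1) le_rfl (by omega)
        simp only [e1] at this
        linarith [this, mul_comm (T (v₁ + 2) (v₂ - 1)) (T (v₁ + 1) (v₂ + k)),
          mul_comm (T (v₁ + 2) (v₂ + k)) (T (v₁ + 1) (v₂ - 1))]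
      have hprod := hT.m2_mul_m2 (v₁ + 1) (v₂ + k) v₁ v₂
      simp only [e1, e2] at hprod
      have key := two_bracket (a := T (v₁ + 3) (v₂ + k - 1) * T v₁ v₂)
        (b := T (v₁ + 2) (v₂ + k) * T (v₁ + 1) (v₂ - 1))
        (c := T (v₁ + 2) (v₂ - 1) * T (v₁ + 1) (v₂ + k)) (d := T (v₁ + 1) v₂ * T (v₁ + 2) (v₂ + k - 1))
        (mul_nonneg (hT.nonneg _ _) (hT.nonneg _ _)) (mul_nonneg (hT.nonneg _ _) (hT.nonneg _ _))
        (mul_nonneg (hT.nonneg _ _) (hT.nonneg _ _)) (by linarith [hs]) hcb (by nlinarith [hprod])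
      linarith [key]
  · -- k ≥ 1: the signed bracket is crossB v u
    have hs : crossB T v₁ v₂ (v₁ + 1) (v₂ + k) ≤ 0 := hT.crossB_nonpos (by omega) (by omega)
    unfold crossB at hs ⊢
    simp only [e1, e2] at hs ⊢
    have hcb : T (v₁ + 3) (v₂ + k - 1) * T v₁ v₂ ≤ T (v₁ + 1) v₂ * T (v₁ + 2) (v₂ + k - 1) := by
      have := hT.d1_quad (a := v₁) (b := v₂) (a' := v₁ + 2) (b' := v₂ + k - 1) (by omega) (by omega)
      simp only [e3] at this
      exact this
    have hprod := hT.m2_mul_m2 v₁ v₂ (v₁ + 1) (v₂ + k)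
    simp only [e1, e2] at hprod
    have key := two_bracket (a := T (v₁ + 2) (v₂ - 1) * T (v₁ + 1) (v₂ + k))
      (b := T (v₁ + 1) v₂ * T (v₁ + 2) (v₂ + k - 1))
      (c := T (v₁ + 3) (v₂ + k - 1) * T v₁ v₂) (d := T (v₁ + 2) (v₂ + k) * T (v₁ + 1) (v₂ - 1))
      (mul_nonneg (hT.nonneg _ _) (hT.nonneg _ _)) (mul_nonneg (hT.nonneg _ _) (hT.nonneg _ _))
      (mul_nonneg (hT.nonneg _ _) (hT.nonneg _ _)) (by linarith [hs]) hcb (by nlinarith [hprod])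
    linarith [key]

/-- **the pair-coefficient sign rule**: the coefficient of `N(s)N(t)` in the `m2` defect of `T ⊛ N`
is `≤ 0` whenever the two points differ by at most one in the first coordinate -/
theorem pair_coeff_nonpos {u₁ u₂ v₁ v₂ : ℤ} (h : |u₁ - v₁| ≤ 1) :
    crossB T u₁ u₂ v₁ v₂ + crossB T v₁ v₂ u₁ u₂ ≤ 0 := by
  rcases (show u₁ = v₁ ∨ u₁ = v₁ + 1 ∨ v₁ = u₁ + 1 by rw [abs_le] at h; omega) with e | e | e
  · subst e
    rcases lt_trichotomy u₂ v₂ with hlt | heq | hgt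
    · obtain ⟨k, hk, rfl⟩ : ∃ k, 1 ≤ k ∧ v₂ = u₂ + k := ⟨v₂ - u₂, by omega, by ring⟩
      have := hT.pair_vert (v₁ := u₁) (v₂ := u₂) hk
      linarith [this]
    · subst heq
      have := hT.crossB_nonpos (u₁ := u₁) (u₂ := u₂) (v₁ := u₁) (v₂ := u₂) (by omega) le_rfl
      linarith [this]
    · obtain ⟨k, hk, rfl⟩ : ∃ k, 1 ≤ k ∧ u₂ = v₂ + k := ⟨u₂ - v₂, by omega, by ring⟩
      exact hT.pair_vert hk
  · subst e
    obtain ⟨k, rfl⟩ : ∃ k, u₂ = v₂ + k := ⟨u₂ - v₂, by ring⟩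
    exact hT.pair_diag
  · subst e
    obtain ⟨k, rfl⟩ : ∃ k, v₂ = u₂ + k := ⟨v₂ - u₂, by ring⟩
    have := hT.pair_diag (v₁ := u₁) (v₂ := u₂) (k := k)
    linarith [this]

end IsMTail

end Summit.Ventures.PercRepro2.Tail2D
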